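import Literature.NumberTheory.GaloisRepresentations.EisensteinSexticAuxiliaryPrime
import Literature.NumberTheory.GaloisRepresentations.CharacterNormalisedGeneratorHeckeCharacter
import HarnessLib

/-!
# The Größencharakter of `y² = x³ + k` is ramified above the primes of `2k` away from `3`, I: the witness engine and the cubic witness
# (Ireland–Rosen Ch. 18 §7 «if `P ∣ 6D` then `χ(P) = 0`»; Silverman *ATAEC* II Thm. 9.2 (b))

Topic `Literature/NumberTheory/GaloisRepresentations`, namespace `Literature.NumberTheory.GaloisRepresentations.EisensteinSextic` (sequel of
`EisensteinSexticAuxiliaryPrime`; cell `bsd-wall`, seat bed-w3 g17, «FILE C» of the Deuring row `j = 0`).  THEOREMS only, unconditional.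
For `k ≠ 0`, `𝔣 = (36k)`, `ψ = EisensteinSextic.psi` (`ψ(𝔭) = (k/N𝔭)·(4k/𝔭)₃·ϖ_𝔭`, a Größencharakter mod `𝔣` of type `(1,0)`, seat bed-w1) and
a prime `𝔭_w ∣ 36k` over `p ≠ 3`:

* §7 `idealPow_psi_span_prime` (`ψ̃((ϖ)) = (k/N𝔮)·e(χ_𝔮(4k))·e(ϖ)` at an auxiliary principal prime `𝔮 = (ϖ)`, `ϖ ≡ 1 (3)`), ★
  `not_isUnramifiedAt_psi_of_prime` (ramification at `𝔭_w` from `(k/N𝔮)·e(χ_𝔮(4k)) ≠ 1`), ★ `exists_auxPrime` (Landau + CRT: `𝔮 = (ϖ) ∤ 36k` of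
  prime norm with `ϖ ≡ g (mod 𝔭_w^{n_w})`, `ϖ ≡ 1 (mod 𝔭_v^{n_v})` for `v ≠ w`), `auxPrime_sub_one_mem` (`ϖ ≡ 1 (mod 9m)` for `4k = p^v m`,
  `p ∉ 𝔮`), `residueCard_mul_sub_sq_mem` (split case: `N𝔮·ϖ ≡ g² (mod 𝔭_w)`), `natCast_absNorm_span_eq_mul_smul` (`N((ϖ)) = ϖ·cϖ`),
  `algEquiv_mul_self` (`c² = 1`);
* §8 ★★ `not_isUnramifiedAt_psi_of_not_three_dvd` — **`ψ` is ramified at `𝔭_w` whenever `3 ∤ ord_p(4k)`** (the cubic part: `K(∛4k)/K`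
  ramifies at `p`): with a non-cube `g`, `ψ̃((ϖ))/e(ϖ) = ±χ_w(g)^{ord_p 4k} ≠ 1`.  Covers `p ≥ 5` with `ord_p k ∈ {1,2,4,5}` and `p = 2` with
  `ord₂ k ∈ {0,2,3,5}`; the remaining cases (`ord_p k = 3`; `p = 2` with `ord₂ k ∈ {1, 4}`) are quadratic and live in the sequels.

Nothing about BSD is proved here; no modularity is used.

## References
* K. Ireland, M. Rosen, *A Classical Introduction to Modern Number Theory*, 2nd ed., GTM 84 (1990), Ch. 5 §2 (Jacobi symbol, reciprocity),
  Ch. 9 §1 (`ℤ[ω]`), §3 Theorem 1 (cubic reciprocity) with §4 (proof), Ch. 18 §3 Theorem 4, §6 Theorem 7 (proof: «`χ` is a Hecke character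
  … with conductor dividing `12D`»), §7 («if `P ∣ 6D` define `χ(P) = 0`», Theorem 4′). [IrelandRosen1990]
* J. Neukirch, *Algebraic Number Theory* (1999), Ch. I §3, Ch. VI §1 (1.7)–(1.9), Ch. VII §6 (6.13)–(6.14), §13 (13.2). [NeukirchANT1999]
* E. Landau, *Über Ideale und Primideale in Idealklassen*, Math. Z. 2 (1918), §1. [Landau1918Idealklassen]
* J. H. Silverman, *Advanced Topics in the Arithmetic of Elliptic Curves* (1994), II Thm. 9.2, Thm. 10.5. [SilvermanATAEC1994]

## Mathlib / tree search
Tree: §§4–6 of `EisensteinSexticAuxiliaryPrime`; `psi`, `modulus`, `modulus_le_iff`, `idealPow_psi_span`, `isGrossencharakter_psi_one_zero`,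
`hsurj_three`, `hinj_three`, `gcd_absNorm_eq_one`, `subsingleton_infinitePlace`, `exists_algEquiv_ne_one`, `algEquiv_eq_of_ne_one`,
`natCast_absNorm_span`, `algebraMap_norm_eq`, `intCast_mem_smul_iff`, `smul_ne_self_of_mod_three_eq_one` (`EisensteinSextic*`, seat bed-w1);
`not_isUnramifiedAt_heckeOfGross_of_ne` (`CharacterNormalisedGeneratorHeckeCharacter`); `sub_one_mem_pow_modulusExp_of_dvd`,
`heightOneSpectrum_eq_of_dvd_pow` (`QuarticTwistGrossencharakterRamification`); `primarize_eq_of` (`PrimaryGeneratorHeckeCharacter`).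
Mathlib: `Fintype.prod_subsingleton`, `jacobiSym.eq_one_or_neg_one`, `Algebra.coe_norm_int`, `AlgEquiv.smul_def`.
-/

noncomputable section

open NumberField IsDedekindDomain IsDedekindDomain.HeightOneSpectrum
open scoped NumberTheorySymbols ComplexConjugate Pointwise

namespace Literature.NumberTheory.GaloisRepresentations.EisensteinSextic

open Literature.NumberTheory.GaloisRepresentations
open Literature.NumberTheory.LFunctions (idealPow isCoprime_span_of_sub_mem RayClassRel CoprimeIdeal
  exists_rayClassRel_prime_absNorm_not_mem)
open Literature.NumberTheory.LFunctions.AbelianDensity (artinSymbol artinSymbol_asIdeal)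
open Literature.NumberTheory.Automorphic (RingOfIntegers.coe_algEquiv_smul HeightOneSpectrum.smul_mem_smul_asIdeal_iff)

variable {K : Type} [Field K] [NumberField K]

section Witness

variable {ζ : 𝓞 K} (hζ : IsPrimitiveRoot ζ 3) [IsCyclotomicExtension {3} ℚ K]

omit [NumberField K] [IsCyclotomicExtension {3} ℚ K] in
/-- `(36k) + 𝔮 = 1` gives `3 ∉ 𝔮` and `4k ∉ 𝔮`. [cite: IrelandRosen1990, Ch. 18 §7 («`P ∤ 6D`»)] -/
theorem three_not_mem_and_four_mul_not_mem {k : ℤ} {𝔮 : HeightOneSpectrum (𝓞 K)} (h : IsCoprime 𝔮.asIdeal (modulus k)) :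
    (3 : 𝓞 K) ∉ 𝔮.asIdeal ∧ ((4 * k : ℤ) : 𝓞 K) ∉ 𝔮.asIdeal := by
  rw [modulus] at h
  exact ⟨not_mem_of_isCoprime_span_of_dvd h ⟨((12 * k : ℤ) : 𝓞 K), by push_cast; ring⟩,
    not_mem_of_isCoprime_span_of_dvd h ⟨9, by push_cast; ring⟩⟩

include hζ in
/-- ★ **`ψ̃` at an auxiliary principal prime**: for `𝔮 = (ϖ)` prime to `36k` with `ϖ ≡ 1 (mod 3)`,
`ψ̃((ϖ)) = (k/N𝔮) · e(χ_𝔮(4k)) · e(ϖ)` (`idealPow_psi_span` with `S((ϖ)) = cubicLoc(𝔮) = e(χ_𝔮(4k))` and `primarize ϖ = ϖ`).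
[cite: IrelandRosen1990, Ch. 18 §6, proof of Theorem 7] -/
theorem idealPow_psi_span_prime {k : ℤ} (hk : k ≠ 0) (e : K →+* ℂ) {ϖ : 𝓞 K} {𝔮 : HeightOneSpectrum (𝓞 K)}
    (hϖ : Ideal.span {ϖ} = 𝔮.asIdeal) (hcop : IsCoprime (Ideal.span {ϖ}) (modulus k)) (hϖ3 : ϖ - 1 ∈ Ideal.span {(3 : 𝓞 K)}) :
    idealPow K (psi hζ k e) (Ideal.span {ϖ}) =
      (J(k | Ideal.absNorm 𝔮.asIdeal) : ℂ) * e (cubicResidueSymbol 𝔮 (Ideal.Quotient.mk 𝔮.asIdeal ((4 * k : ℤ) : 𝓞 K)) : K) * e ϖ := by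
  have hϖ0 : ϖ ≠ 0 := fun h => 𝔮.ne_bot (by rw [← hϖ, h, Ideal.span_singleton_eq_bot])
  have hcop' : IsCoprime 𝔮.asIdeal (modulus k) := by rwa [hϖ] at hcop
  obtain ⟨h3, h4k⟩ := three_not_mem_and_four_mul_not_mem hcop'
  have hcop3 : IsCoprime (Ideal.span {ϖ}) (Ideal.span {(3 : 𝓞 K)}) := isCoprime_span_singleton_of_sub_one_mem hϖ3
  have hprim : primarize (hsurj_three hζ) ϖ = ϖ := primarize_eq_of (hsurj_three hζ) (hinj_three hζ) hcop3 rfl hϖ3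
  rw [idealPow_psi_span hζ hk e hϖ0 hcop, hϖ, artinSymbol_asIdeal, coe_cubicLoc_of_not_mem hζ e h4k h3, hprim]

include hζ in
/-- ★★ **Ramification from an auxiliary prime**: if `𝔮 = (ϖ) ∤ 36k` with `ϖ ∉ 𝔭_w ∣ 36k`, `ϖ ≡ 1 (mod 𝔭_v^{n_v})` at every other prime
power of `(36k)`, and `(k/N𝔮) · e(χ_𝔮(4k)) ≠ 1`, then `heckeOfGross ψ` is RAMIFIED at `𝔭_w` (`not_isUnramifiedAt_heckeOfGross_of_ne`
with the witness `a = ϖ`: `ψ̃((ϖ)) ≠ e(ϖ)`). [cite: NeukirchANT1999, Ch. VII §6 Prop. (6.13)] [cite: IrelandRosen1990, Ch. 18 §7 («if `P ∣ 6D` then `χ(P) = 0`»)] -/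
theorem not_isUnramifiedAt_psi_of_prime {k : ℤ} (hk : k ≠ 0) (w₀ : InfinitePlace K) {w : HeightOneSpectrum (𝓞 K)}
    (hw : modulus k ≤ w.asIdeal) {ϖ : 𝓞 K} {𝔮 : HeightOneSpectrum (𝓞 K)} (hϖ : Ideal.span {ϖ} = 𝔮.asIdeal)
    (hϖw : ϖ ∉ w.asIdeal) (hcop : IsCoprime (Ideal.span {ϖ}) (modulus k)) (hϖ3 : ϖ - 1 ∈ Ideal.span {(3 : 𝓞 K)})
    (hcong : ∀ v : HeightOneSpectrum (𝓞 K), v ≠ w → modulusExp (modulus k) v ≠ 0 → ϖ - 1 ∈ v.asIdeal ^ modulusExp (modulus k) v)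
    (hne : (J(k | Ideal.absNorm 𝔮.asIdeal) : ℂ) *
      w₀.embedding (cubicResidueSymbol 𝔮 (Ideal.Quotient.mk 𝔮.asIdeal ((4 * k : ℤ) : 𝓞 K)) : K) ≠ 1) :
    ¬ (heckeOfGross (modulus_ne_bot hk) (isGrossencharakter_psi_one_zero hζ hk w₀)).IsUnramifiedAt w := by
  haveI := subsingleton_infinitePlace (K := K)
  haveI : IsTotallyComplex K := IsCyclotomicExtension.Rat.isTotallyComplex K (n := 3) (by norm_num)
  have hϖ0 : ϖ ≠ 0 := fun h => 𝔮.ne_bot (by rw [← hϖ, h, Ideal.span_singleton_eq_bot])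
  refine not_isUnramifiedAt_heckeOfGross_of_ne (modulus_ne_bot hk) (isGrossencharakter_psi_one_zero hζ hk w₀) hw hϖw hcop
    hcong ?_
  rw [idealPow_psi_span_prime hζ hk w₀.embedding hϖ hcop hϖ3, Fintype.prod_subsingleton _ w₀]
  simp only [zpow_one, zpow_zero, mul_one]
  intro h
  apply hne
  have he : w₀.embedding (ϖ : K) ≠ 0 := (map_ne_zero _).mpr (by exact_mod_cast hϖ0)
  exact mul_right_cancel₀ he (by rw [one_mul]; exact h)


omit [IsCyclotomicExtension {3} ℚ K] in
/-- ★ **The auxiliary prime for a place `𝔭_w ∣ 36k`** and a seed `g ∉ 𝔭_w`: with `(36k) = J_w · 𝔭_w^{n_w}` and a CRT element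
`g₀ ≡ 1 (mod J_w)`, `g₀ ≡ g (mod 𝔭_w^{n_w})`, Landau's theorem gives a principal prime `𝔮 = (ϖ) ∤ 36k` of prime norm with `ϖ ≡ g₀ (mod 36k)`;
then `ϖ ≡ g (mod 𝔭_w)`, `ϖ ∉ 𝔭_w`, `(ϖ)` is prime to `36k` and `ϖ ≡ 1 (mod 𝔭_v^{n_v})` at every `v ≠ w`.
[cite: Landau1918Idealklassen, §1 Satz] [cite: NeukirchANT1999, Ch. VII §6 Prop. (6.13)] -/
theorem exists_auxPrime {k : ℤ} (hk : k ≠ 0) {w : HeightOneSpectrum (𝓞 K)} (hw : modulus k ≤ w.asIdeal)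
    (g : 𝓞 K) (hg : g ∉ w.asIdeal) :
    ∃ (J : Ideal (𝓞 K)) (g₀ ϖ : 𝓞 K) (𝔮 : HeightOneSpectrum (𝓞 K)),
      modulus k = J * w.asIdeal ^ modulusExp (modulus k) w ∧ g₀ - 1 ∈ J ∧
      g₀ - g ∈ w.asIdeal ^ modulusExp (modulus k) w ∧ IsCoprime (Ideal.span {g₀}) (modulus k) ∧
      Ideal.span {ϖ} = 𝔮.asIdeal ∧ ϖ - g₀ ∈ modulus k ∧ (Ideal.absNorm 𝔮.asIdeal).Prime ∧
      IsCoprime (Ideal.span {ϖ}) (modulus k) ∧ ϖ - g ∈ w.asIdeal ∧ ϖ ∉ w.asIdeal ∧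
      (∀ v : HeightOneSpectrum (𝓞 K), v ≠ w → modulusExp (modulus k) v ≠ 0 →
        ϖ - 1 ∈ v.asIdeal ^ modulusExp (modulus k) v) ∧
      (∀ v : HeightOneSpectrum (𝓞 K), v ≠ w → modulusExp (modulus k) v ≠ 0 →
        g₀ - 1 ∈ v.asIdeal ^ modulusExp (modulus k) v) := by
  have h𝔣 : modulus (K := K) k ≠ ⊥ := modulus_ne_bot hk
  have he : modulusExp (modulus k) w ≠ 0 := (modulusExp_ne_zero_iff _ h𝔣 w).mpr hw
  obtain ⟨J, h𝔣J, hJw⟩ := exists_eq_mul_pow_modulusExp h𝔣 w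
  obtain ⟨g₀, hg₀1, hg₀g⟩ := exists_sub_one_mem_and_sub_mem (hJw.pow_right (n := modulusExp (modulus k) w)) g
  have hpow_le : w.asIdeal ^ modulusExp (modulus k) w ≤ w.asIdeal := Ideal.pow_le_self he
  have hg₀w : g₀ ∉ w.asIdeal := fun h => hg (by
    have := w.asIdeal.sub_mem h (hpow_le hg₀g); rwa [sub_sub_cancel] at this)
  have hg₀0 : g₀ ≠ 0 := fun h => hg₀w (h ▸ w.asIdeal.zero_mem)
  have hg₀cop : IsCoprime (Ideal.span {g₀}) (modulus k) := by
    rw [h𝔣J]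
    exact (isCoprime_span_singleton_of_sub_one_mem hg₀1).mul_right
      (isCoprime_span_singleton_asIdeal_of_not_mem hg₀w).pow_right
  obtain ⟨ϖ, 𝔮, -, hϖ, hϖg₀, hprime, h𝔮⟩ := exists_prime_generator_sub_mem h𝔣 hg₀0 hg₀cop ∅ Set.finite_empty
  have hϖcop : IsCoprime (Ideal.span {ϖ}) (modulus k) := isCoprime_span_of_sub_mem hg₀cop hϖg₀
  have hϖg : ϖ - g ∈ w.asIdeal := by
    have : ϖ - g = (ϖ - g₀) + (g₀ - g) := by ring
    rw [this]; exact w.asIdeal.add_mem (hw hϖg₀) (hpow_le hg₀g)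
  have hϖw : ϖ ∉ w.asIdeal := fun h => hg (by
    have := w.asIdeal.sub_mem h hϖg; rwa [sub_sub_cancel] at this)
  have hg₀v : ∀ v : HeightOneSpectrum (𝓞 K), v ≠ w → modulusExp (modulus k) v ≠ 0 →
      g₀ - 1 ∈ v.asIdeal ^ modulusExp (modulus k) v := fun v hv _ =>
    sub_one_mem_pow_modulusExp_of_dvd (dvd_of_eq h𝔣J) (fun v' hv' => heightOneSpectrum_eq_of_dvd_pow hv') hg₀1 hv
  refine ⟨J, g₀, ϖ, 𝔮, h𝔣J, hg₀1, hg₀g, hg₀cop, hϖ, hϖg₀, hprime, hϖcop, hϖg, hϖw, fun v hv he' => ?_, hg₀v⟩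
  have : ϖ - 1 = (ϖ - g₀) + (g₀ - 1) := by ring
  rw [this]
  exact (v.asIdeal ^ modulusExp (modulus k) v).add_mem (Ideal.le_of_dvd (pow_modulusExp_dvd v) hϖg₀) (hg₀v v hv he')

omit [NumberField K] [IsCyclotomicExtension {3} ℚ K] in
/-- `(±1) · e(μ) ≠ 1` for a cube root of unity `μ ≠ 1` of `𝓞 K` (then `μ² ≠ 1`, so `e(μ) ≠ ±1`). [cite: IrelandRosen1990, Ch. 18 §7] -/
theorem intCast_mul_embedding_ne_one (e : K →+* ℂ) {j : ℤ} (hj : j = 1 ∨ j = -1) {μ : 𝓞 K} (hμ3 : μ ^ 3 = 1) (hμ1 : μ ≠ 1) :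
    (j : ℂ) * e (μ : K) ≠ 1 := by
  intro h
  have hsq : e ((μ : K) ^ 2) = 1 := by
    have h2 : ((j : ℂ) * e (μ : K)) ^ 2 = 1 := by rw [h, one_pow]
    rw [mul_pow] at h2
    rcases hj with rfl | rfl
    · simpa [map_pow] using h2
    · simpa [map_pow] using h2
  have hμ2 : μ ^ 2 = 1 := by
    have : ((μ : K)) ^ 2 = 1 := e.injective (by rw [hsq, map_one])
    exact_mod_cast this
  apply hμ1
  calc μ = μ * μ ^ 2 := by rw [hμ2, mul_one]
    _ = μ ^ 3 := by ring
    _ = 1 := hμ3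


omit [NumberField K] [IsCyclotomicExtension {3} ℚ K] in
/-- A non-trivial cube root of unity stays non-trivial under powers prime to `3`. [cite: IrelandRosen1990, Ch. 9 §3 Prop. 9.3.3] -/
theorem pow_ne_one_of_not_three_dvd {μ : 𝓞 K} (hμ3 : μ ^ 3 = 1) (hμ1 : μ ≠ 1) {v : ℕ} (hv : ¬ 3 ∣ v) :
    μ ^ v ≠ 1 ∧ (μ ^ v) ^ 3 = 1 := by
  refine ⟨fun h => ?_, by rw [← pow_mul, mul_comm, pow_mul, hμ3, one_pow]⟩
  have hμ2 : μ ^ 2 ≠ 1 := fun h2 => hμ1 (by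
    calc μ = μ * μ ^ 2 := by rw [h2, mul_one]
      _ = μ ^ 3 := by ring
      _ = 1 := hμ3)
  have hred : μ ^ v = μ ^ (v % 3) := by
    conv_lhs => rw [← Nat.div_add_mod v 3, pow_add, pow_mul, hμ3, one_pow, one_mul]
  rw [hred] at h
  have h3 : v % 3 = 1 ∨ v % 3 = 2 := by omega
  rcases h3 with h1 | h2
  · rw [h1, pow_one] at h; exact hμ1 h
  · rw [h2] at h; exact hμ2 h

/-- The non-trivial automorphism of `ℚ(ω)` is an involution. [cite: IrelandRosen1990, Ch. 9 §1] -/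
theorem algEquiv_mul_self {c : K ≃ₐ[ℚ] K} (hc : c ≠ 1) : c * c = 1 := by
  by_contra h
  exact hc (by
    have h2 := algEquiv_eq_of_ne_one h hc
    calc c = c * c * c⁻¹ := by group
      _ = c * c⁻¹ := by rw [h2]
      _ = 1 := mul_inv_cancel c)

/-- `N((ϖ)) = ϖ · cϖ` in `𝓞 K`. [cite: IrelandRosen1990, Ch. 9 §1 (`N(α) = α ᾱ`)] -/
theorem natCast_absNorm_span_eq_mul_smul {c : K ≃ₐ[ℚ] K} (hc : c ≠ 1) (ϖ : 𝓞 K) :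
    ((Ideal.absNorm (Ideal.span {ϖ}) : ℕ) : 𝓞 K) = ϖ * c • ϖ := by
  apply RingOfIntegers.ext
  have h1 : (((Ideal.absNorm (Ideal.span {ϖ}) : ℕ) : 𝓞 K) : K) = ((Algebra.norm ℤ ϖ : ℤ) : K) := by
    rw [← natCast_absNorm_span ϖ]; push_cast; rfl
  rw [h1]
  push_cast
  rw [AlgEquiv.smul_def, ← algebraMap_norm_eq hc (ϖ : K), ← Algebra.coe_norm_int ϖ, map_intCast]

include hζ in
/-- **The split-case congruence `N𝔮·ϖ ≡ g² (mod 𝔭_w)`**: for `𝔭_w ∣ 36k` of degree one over `p ≠ 3` (so `c𝔭_w ≠ 𝔭_w` also divides `36k`) and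
`ϖ ≡ 1` modulo the prime powers of `(36k)` away from `𝔭_w`: `cϖ ≡ 1 (mod 𝔭_w)`, `N𝔮 = ϖ·cϖ`, `ϖ ≡ g`. [cite: IrelandRosen1990, Ch. 9 §1, Ch. 18 §7] -/
theorem residueCard_mul_sub_sq_mem {k : ℤ} (hk : k ≠ 0) {w : HeightOneSpectrum (𝓞 K)} (hw : modulus k ≤ w.asIdeal)
    {p : ℕ} (hp : p.Prime) (hp3 : p ≠ 3) (hpw : (p : 𝓞 K) ∈ w.asIdeal) (hwp : w.residueCard = p)
    {ϖ : 𝓞 K} {𝔮 : HeightOneSpectrum (𝓞 K)} (hϖ : Ideal.span {ϖ} = 𝔮.asIdeal) {g : 𝓞 K} (hϖg : ϖ - g ∈ w.asIdeal)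
    (hcong : ∀ v : HeightOneSpectrum (𝓞 K), v ≠ w → modulusExp (modulus k) v ≠ 0 →
      ϖ - 1 ∈ v.asIdeal ^ modulusExp (modulus k) v) :
    (𝔮.residueCard : 𝓞 K) * ϖ - g ^ 2 ∈ w.asIdeal := by
  have h𝔣 : modulus (K := K) k ≠ ⊥ := modulus_ne_bot hk
  -- `p ≡ 1 (mod 3)`: an inert prime has `N = p² ≠ p`
  have hp31 : p % 3 = 1 := by
    have h0 : p % 3 ≠ 0 := fun h => hp3 ((Nat.prime_dvd_prime_iff_eq Nat.prime_three hp).mp (Nat.dvd_of_mod_eq_zero h)).symm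
    by_contra h1
    have h2 : p % 3 = 2 := by omega
    have hN : w.residueCard = p ^ 2 := by
      rw [show w.residueCard = Ideal.absNorm w.asIdeal from rfl, asIdeal_eq_span_of_mod_three_eq_two hp h2 hpw,
        show ((p : ℕ) : 𝓞 K) = ((p : ℤ) : 𝓞 K) by push_cast; rfl, absNorm_span_intCast, Int.natAbs_natCast]
    rw [hwp] at hN
    exact absurd hN (by nlinarith [hp.two_le])
  obtain ⟨c, hc⟩ := exists_algEquiv_ne_one (K := K)
  have hcw : c • w ≠ w := smul_ne_self_of_mod_three_eq_one hζ hc hp hp31 hpw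
  have hpcw : (p : 𝓞 K) ∈ (c • w).asIdeal := by
    have h := (intCast_mem_smul_iff c w (p : ℤ)).mpr (by exact_mod_cast hpw)
    exact_mod_cast h
  have hcw𝔣 : modulus k ≤ (c • w).asIdeal := by
    rw [modulus_le_iff] at hw ⊢
    exact (intCast_mem_smul_iff c w _).mpr hw
  have he : modulusExp (modulus k) (c • w) ≠ 0 := (modulusExp_ne_zero_iff _ h𝔣 _).mpr hcw𝔣
  have h1 : ϖ - 1 ∈ (c • w).asIdeal := Ideal.pow_le_self he (hcong (c • w) hcw he)
  -- apply `c`: `cϖ − 1 ∈ c • (c • w) = w`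
  have h2 : c • ϖ - 1 ∈ w.asIdeal := by
    have h := (HeightOneSpectrum.smul_mem_smul_asIdeal_iff c (c • w) (ϖ - 1)).mpr h1
    rw [smul_smul, algEquiv_mul_self hc, one_smul, smul_sub, smul_one] at h
    exact h
  rw [show (𝔮.residueCard : 𝓞 K) = ((Ideal.absNorm (Ideal.span {ϖ}) : ℕ) : 𝓞 K) by rw [hϖ]; rfl,
    natCast_absNorm_span_eq_mul_smul hc ϖ]
  have : ϖ * c • ϖ * ϖ - g ^ 2 = ϖ ^ 2 * (c • ϖ - 1) + (ϖ - g) * (ϖ + g) := by ring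
  rw [this]
  exact w.asIdeal.add_mem (w.asIdeal.mul_mem_left _ h2) (w.asIdeal.mul_mem_right _ hϖg)

omit [IsCyclotomicExtension {3} ℚ K] in
/-- **Bookkeeping at the auxiliary prime**: with `4k = p^v m`, `p ∤ m`, `v ≠ 0`, `(36k) = J·𝔭_w^{n_w}` (`𝔭_w ∋ p`), `g₀ ≡ 1 (mod J)` and
`ϖ ≡ g₀ (mod 36k)`, `(ϖ) = 𝔮` prime to `36k`: `(9m) ∣ J` (as `36k = 9m·p^v` and `(9m, 𝔭_w) = 1`), so `ϖ ≡ 1 (mod 9m)`, `ϖ ≡ 1 (mod 3)`,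
and `p ∉ 𝔮`. [cite: NeukirchANT1999, Ch. I §3 Thm. (3.3)] -/
theorem auxPrime_sub_one_mem {k : ℤ} {p : ℕ} (hp : p.Prime) (hp3 : p ≠ 3) {v : ℕ} {m : ℤ}
    (hkm : 4 * k = (p : ℤ) ^ v * m) (hpm : ¬ (p : ℤ) ∣ m) (hv0 : v ≠ 0)
    {w : HeightOneSpectrum (𝓞 K)} (hpw : (p : 𝓞 K) ∈ w.asIdeal) {J : Ideal (𝓞 K)}
    (h𝔣J : modulus k = J * w.asIdeal ^ modulusExp (modulus k) w) {g₀ ϖ : 𝓞 K} (hg₀1 : g₀ - 1 ∈ J)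
    (hϖg₀ : ϖ - g₀ ∈ modulus k) {𝔮 : HeightOneSpectrum (𝓞 K)} (hϖ : Ideal.span {ϖ} = 𝔮.asIdeal)
    (hϖcop : IsCoprime (Ideal.span {ϖ}) (modulus k)) :
    g₀ - 1 ∈ Ideal.span {((9 * m : ℤ) : 𝓞 K)} ∧ ϖ - 1 ∈ Ideal.span {((9 * m : ℤ) : 𝓞 K)} ∧
      ϖ - 1 ∈ Ideal.span {(3 : 𝓞 K)} ∧ (p : 𝓞 K) ∉ 𝔮.asIdeal := by
  have hpZ : Prime (p : ℤ) := Nat.prime_iff_prime_int.mp hp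
  have h36 : (36 * k : ℤ) = 9 * m * (p : ℤ) ^ v := by linear_combination 9 * hkm
  -- `(9m, p) = 1` in `ℤ`
  have h9m : ¬ (p : ℤ) ∣ 9 * m := by
    intro h
    rcases hpZ.dvd_or_dvd h with h9 | hm'
    · have h3 : (p : ℤ) ∣ 3 := hpZ.dvd_of_dvd_pow (n := 2) (by norm_num; exact h9)
      have : p ∣ 3 := by exact_mod_cast h3
      exact hp3 ((Nat.prime_dvd_prime_iff_eq hp Nat.prime_three).mp this)
    · exact hpm hm'
  have hcopZ : IsCoprime (9 * m : ℤ) (p : ℤ) := (hpZ.irreducible.coprime_iff_not_dvd.mpr h9m).symm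
  have hcop_p : IsCoprime (Ideal.span {((9 * m : ℤ) : 𝓞 K)}) (Ideal.span {(p : 𝓞 K)}) := by
    rw [Ideal.isCoprime_span_singleton_iff]
    simpa using hcopZ.map (Int.castRingHom (𝓞 K))
  have hcop_w : IsCoprime (Ideal.span {((9 * m : ℤ) : 𝓞 K)}) w.asIdeal := by
    rw [Ideal.isCoprime_iff_sup_eq] at hcop_p ⊢
    exact top_le_iff.mp (hcop_p ▸ sup_le_sup_left ((Ideal.span_singleton_le_iff_mem _).mpr hpw) _)
  -- `(9m) ∣ J`
  have hdvd𝔣 : Ideal.span {((9 * m : ℤ) : 𝓞 K)} ∣ modulus (K := K) k := by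
    refine ⟨Ideal.span {(p : 𝓞 K) ^ v}, ?_⟩
    rw [modulus, Ideal.span_singleton_mul_span_singleton, h36]; push_cast; ring_nf
  have hdvdJ : Ideal.span {((9 * m : ℤ) : 𝓞 K)} ∣ J :=
    (hcop_w.pow_right (n := modulusExp (modulus k) w)).dvd_of_dvd_mul_right (h𝔣J ▸ hdvd𝔣)
  have h9 : ϖ - 1 ∈ Ideal.span {((9 * m : ℤ) : 𝓞 K)} := by
    have : ϖ - 1 = (ϖ - g₀) + (g₀ - 1) := by ring
    rw [this]
    exact (Ideal.span _).add_mem (Ideal.le_of_dvd hdvd𝔣 hϖg₀) (Ideal.le_of_dvd hdvdJ hg₀1)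
  refine ⟨Ideal.le_of_dvd hdvdJ hg₀1, h9,
    Ideal.span_singleton_le_span_singleton.mpr ⟨((3 * m : ℤ) : 𝓞 K), by push_cast; ring⟩ h9, ?_⟩
  have hcop𝔮 : IsCoprime 𝔮.asIdeal (modulus k) := by rwa [hϖ] at hϖcop
  rw [modulus] at hcop𝔮
  refine not_mem_of_isCoprime_span_of_dvd hcop𝔮 ⟨((9 * m : ℤ) : 𝓞 K) * (p : 𝓞 K) ^ (v - 1), ?_⟩
  rw [h36]; push_cast
  conv_lhs => rw [← Nat.sub_add_cancel (Nat.pos_of_ne_zero hv0), pow_succ]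
  ring

include hζ in
/-- ★★ **Ramification above `p ∣ 2k`, `p ≠ 3`, when `3 ∤ ord_p(4k)`** (the cubic part of `ψ` is ramified: `K(∛4k)/K` ramifies at `p`):
with a non-cube `g (mod 𝔭_w)` and the auxiliary prime `𝔮 = (ϖ)`, `ϖ ≡ g (mod 𝔭_w)`, `ϖ ≡ 1` elsewhere modulo `36k`:
`ψ̃((ϖ))/e(ϖ) = (k/N𝔮)·χ_𝔮(4k) = ±χ_w(g)^{ord_p 4k} ≠ 1`.  Covers `p ≥ 5` with `ord_p k ∈ {1,2,4,5}` and `p = 2` with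
`ord₂ k ∈ {0,2,3,5}`. [cite: IrelandRosen1990, Ch. 18 §7 (Theorem 4′ and «if `P ∣ 6D` then `χ(P) = 0`»)] [cite: SilvermanATAEC1994, II Thm. 9.2 (b), Thm. 10.5] -/
theorem not_isUnramifiedAt_psi_of_not_three_dvd {k : ℤ} (hk : k ≠ 0) (w₀ : InfinitePlace K) {p : ℕ} [Fact p.Prime]
    (hp3 : p ≠ 3) {v : ℕ} {m : ℤ} (hkm : 4 * k = (p : ℤ) ^ v * m) (hpm : ¬ (p : ℤ) ∣ m) (hv0 : v ≠ 0) (hv3 : ¬ 3 ∣ v)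
    {w : HeightOneSpectrum (𝓞 K)} (hpw : (p : 𝓞 K) ∈ w.asIdeal) (hw : modulus k ≤ w.asIdeal) :
    ¬ (heckeOfGross (modulus_ne_bot hk) (isGrossencharakter_psi_one_zero hζ hk w₀)).IsUnramifiedAt w := by
  have hp := (Fact.out : p.Prime)
  have hp3' : Nat.Coprime p 3 := (Nat.coprime_primes hp Nat.prime_three).mpr hp3
  have h3w : (3 : 𝓞 K) ∉ w.asIdeal := three_not_mem_of_natCast_mem hpw hp3'
  obtain ⟨g, hg, hχg⟩ := exists_cubicResidueSymbol_ne_one hζ h3w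
  obtain ⟨J, g₀, ϖ, 𝔮, h𝔣J, hg₀1, -, -, hϖ, hϖg₀, -, hϖcop, hϖg, hϖw, hcong, -⟩ := exists_auxPrime hk hw g hg
  obtain ⟨-, hϖ9, hϖ3, hp𝔮⟩ := auxPrime_sub_one_mem hp hp3 hkm hpm hv0 hpw h𝔣J hg₀1 hϖg₀ hϖ hϖcop
  have hN := fun hwp : w.residueCard = p => residueCard_mul_sub_sq_mem hζ hk hw hp hp3 hpw hwp hϖ hϖg hcong
  have hcubic := cubicResidueSymbol_intCast_eq_pow hζ hp3 hkm hϖ hϖ9 hp𝔮 hpw hg hϖg hN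
  have hg0 : Ideal.Quotient.mk w.asIdeal g ≠ 0 := fun h0 => hg (Ideal.Quotient.eq_zero_iff_mem.mp h0)
  obtain ⟨hne1, hcube⟩ := pow_ne_one_of_not_three_dvd (cubicResidueSymbol_spec hζ h3w hg0).1 hχg hv3
  have h6k : ((6 * k : ℤ) : 𝓞 K) ∉ 𝔮.asIdeal := by
    have hcop𝔮 : IsCoprime 𝔮.asIdeal (modulus k) := by rwa [hϖ] at hϖcop
    rw [modulus] at hcop𝔮
    exact not_mem_of_isCoprime_span_of_dvd hcop𝔮 ⟨6, by push_cast; ring⟩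
  refine not_isUnramifiedAt_psi_of_prime hζ hk w₀ hw hϖ hϖw hϖcop hϖ3 hcong ?_
  rw [hcubic]
  exact intCast_mul_embedding_ne_one w₀.embedding (jacobiSym.eq_one_or_neg_one (gcd_absNorm_eq_one h6k)) hcube hne1

end Witness

end Literature.NumberTheory.GaloisRepresentations.EisensteinSextic

end
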